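import Summits.QuantumFields.YangMills.Theorems.ScalingWindowSplitSelfNormalisedSkewnessWitnessSmearing
import HarnessLib

/-!
# `SelfNormalisedSkewness` — negative side: the smeared two-point function at fixed lattice step

Route `ScalingWindowSplit`, crux `stmt-QuantumFields-18944`, line `Sketch` (negation branch), support for the
lead's `stub_witnessAssembly`.  For a past-supported test `w` (`tsupport w ⊆ {y₀ < 0}`), the covariance of the
bare smeared `U(1)` curvature fields at `w` and its time reflection `θw` on the torus of side `2L+1` is
`a⁸ β⁻²/2 · TP(w) + O_w(μ_β(G_εᶜ) + ε⁶ + β⁻²ξ)`, where `TP(w) = Σ_{x≠y} w(ax) θw(ay) Σ πK(x−y)²` is the quantity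
controlled by `stub_twoPointSmearing`; the diagonal drops out exactly (`w · θw ≡ 0`).

References: Lüscher 1999 §3; standard.  No definitions of propositions, no named facts.
-/

noncomputable section

open scoped BigOperators ENNReal InnerProductSpace
open MeasureTheory ProbabilityTheory
open Literature.MathematicalPhysics.QuantumLattice Literature.MathematicalPhysics.QuantumFieldTheory
open Literature.Probability.LatticeModels (TorusSite torusGreen Torus.proj box)

namespace Summit.QuantumFields.YangMills.Theorems.SelfNormalisedSkewness.Negative

local notation "ZdSite" => Literature.Probability.LatticeModels.Site 4

/-- A past-supported test and its time reflection have vanishing pointwise product. [folklore] -/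
theorem mul_thetaTest_eq_zero {w : SchwartzMap (EuclideanSpace ℝ (Fin 4)) ℝ}
    (hw : tsupport w ⊆ {y : EuclideanSpace ℝ (Fin 4) | y 0 < 0}) (X : EuclideanSpace ℝ (Fin 4)) :
    w X * thetaTest 4 w X = 0 := by
  rw [thetaTest_apply]
  by_cases h0 : X 0 < 0
  · have hX : timeReflection 4 X ∉ tsupport w := fun h => by
      have h' := hw h
      simp only [Set.mem_setOf_eq, timeReflection_apply, if_true] at h'
      linarith
    rw [image_eq_zero_of_notMem_tsupport hX, mul_zero]
  · have hX : X ∉ tsupport w := fun h => h0 (hw h)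
    rw [image_eq_zero_of_notMem_tsupport hX, zero_mul]

/-- **The smeared bare two-point function at fixed step.**  For a past-supported Schwartz test `w` there is `K`
such that, on the torus of side `2L+1` with spacing `a` (`0 < a ≤ 1`), for `β > 0` and admissible `ε`, the
covariance of the bare smeared `U(1)` curvature fields at `w` and `θw` differs from
`a⁸ β⁻²/2 · Σ_{x ≠ y} w(ax) θw(ay) Σ_{αα'} πK(x − y)²_{αα'}` by at most `K (μ_β(G_εᶜ) + ε⁶ + β⁻² ξ)`. [folklore] -/
theorem smeared_cm2_bound (w : SchwartzMap (EuclideanSpace ℝ (Fin 4)) ℝ)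
    (hw : tsupport w ⊆ {y : EuclideanSpace ℝ (Fin 4) | y 0 < 0}) :
    ∃ K : ℝ, 0 ≤ K ∧ ∀ (L : ℕ) (a β ε : ℝ), 0 < a → a ≤ 1 → 0 < β → 0 < ε → ε ≤ 1 →
      ((2 * L + 1 : ℕ) : ℝ) ^ 4 * ε ≤ 2 * Real.pi → 1 ≤ ε * Real.sqrt β →
      β * Fintype.card (Plaquette 4 (2 * L + 1)) * ε ^ 4 ≤ 1 →
      Fintype.card (Plaquette 4 (2 * L + 1)) * (ε * Real.sqrt β)⁻¹ ^ 6 ≤ 1 →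
      (stdGaussian (LinearMap.range (plaqCoboundary (2 * L + 1)))).real
          {v | ∃ p, ε * Real.sqrt β ≤ |⟪frameV (2 * L + 1) p, v⟫_ℝ|} ≤ 1 / 2 →
      |(∫ U, (smearedLatticeField (actionDensity u1Rep) (box 4 L) a 1 0 w (torusLift (2 * L + 1) U) -
              ∫ U', smearedLatticeField (actionDensity u1Rep) (box 4 L) a 1 0 w (torusLift (2 * L + 1) U')
                ∂(wilsonMeasure u1Rep β : Measure (GaugeConfig 4 (2 * L + 1) Circle))) *
            (smearedLatticeField (actionDensity u1Rep) (box 4 L) a 1 0 (thetaTest 4 w) (torusLift (2 * L + 1) U) -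
              ∫ U', smearedLatticeField (actionDensity u1Rep) (box 4 L) a 1 0 (thetaTest 4 w)
                (torusLift (2 * L + 1) U') ∂(wilsonMeasure u1Rep β : Measure (GaugeConfig 4 (2 * L + 1) Circle)))
          ∂(wilsonMeasure u1Rep β : Measure (GaugeConfig 4 (2 * L + 1) Circle))) -
        a ^ 8 * (β⁻¹ ^ 2 / 2) * ∑ x ∈ box 4 L, ∑ y ∈ (box 4 L).erase x,
          w (a • siteToE x) * thetaTest 4 w (a • siteToE y) *
            ∑ α, ∑ α', maxwellK (2 * L + 1) (Torus.proj (2 * L + 1) x - Torus.proj (2 * L + 1) y) α α' ^ 2| ≤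
        K * ((wilsonMeasure u1Rep β : Measure (GaugeConfig 4 (2 * L + 1) Circle)).real
            {U : GaugeConfig 4 (2 * L + 1) Circle | ∀ p : Plaquette 4 (2 * L + 1), |plaqAngle U p| < ε}ᶜ +
          ε ^ 6 + β⁻¹ ^ 2 * (β * Fintype.card (Plaquette 4 (2 * L + 1)) * ε ^ 4 +
            Fintype.card (Plaquette 4 (2 * L + 1)) * (ε * Real.sqrt β)⁻¹ ^ 6)) := by
  obtain ⟨C, hC0, hsite⟩ := site_cumulants
  obtain ⟨Cw, hCw0, hCw⟩ := sum_box_abs_schwartz_le w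
  obtain ⟨Ct, hCt0, hCt⟩ := sum_box_abs_schwartz_le (thetaTest 4 w)
  refine ⟨Cw * Ct * (C + 10 + C), by positivity, ?_⟩
  intro L a β ε ha ha1 hβ hε hε1 hSε ht hw4 hτ htail
  set S : ℕ := 2 * L + 1 with hS
  set μ : Measure (GaugeConfig 4 S Circle) := wilsonMeasure u1Rep β with hμ
  haveI : IsProbabilityMeasure μ := isProbabilityMeasure_wilsonMeasure (L := S) u1Rep continuous_u1Rep β
  set η := μ.real {U : GaugeConfig 4 S Circle | ∀ p : Plaquette 4 S, |plaqAngle U p| < ε}ᶜ with hη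
  set ξ := β * Fintype.card (Plaquette 4 S) * ε ^ 4 + Fintype.card (Plaquette 4 S) * (ε * Real.sqrt β)⁻¹ ^ 6
    with hξ
  have hη0 : 0 ≤ η := measureReal_nonneg
  have hξ0 : 0 ≤ ξ := by positivity
  have hb : 0 ≤ β⁻¹ := inv_nonneg.2 hβ.le
  have hεπ : ε ≤ Real.pi := hε1.trans (by linarith [Real.pi_gt_three])
  have h6 : 6 * ε ≤ 2 * Real.pi := by linarith [Real.pi_gt_three]
  have site := fun x y => (hsite S β ε hβ hε hε1 hεπ hSε h6 ht hw4 hτ htail x y x).2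
  -- site expansion
  obtain ⟨CO, hCO⟩ := u1LatticeRep.curvature.bounded
  have hOm : Measurable (actionDensity u1Rep : LGConfig 4 Circle → ℝ) := u1LatticeRep.curvature.measurable
  rw [integral_centered_mul_eq_sum hOm hCO (box 4 L) a w (thetaTest 4 w) μ]
  have hX : ∀ x : ZdSite, (fun U : GaugeConfig 4 S Circle => actionDensity u1Rep (configShift (-x) (torusLift S U))) =
      Fsite (Torus.proj S x) := fun x => funext fun U => actionDensity_u1_site_eq_sum_cos U x
  have hcm : ∀ x y : ZdSite,
      ∫ U, (actionDensity u1Rep (configShift (-x) (torusLift S U)) -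
            ∫ U', actionDensity u1Rep (configShift (-x) (torusLift S U')) ∂μ) *
          (actionDensity u1Rep (configShift (-y) (torusLift S U)) -
            ∫ U', actionDensity u1Rep (configShift (-y) (torusLift S U')) ∂μ) ∂μ =
        cm2 μ (Fsite (Torus.proj S x)) (Fsite (Torus.proj S y)) := by
    intro x y
    rw [← hX x, ← hX y]
    rfl
  simp_rw [hcm]
  -- split
  set K2 : ZdSite → ZdSite → ℝ := fun x y =>
    ∑ α, ∑ α', maxwellK S (Torus.proj S x - Torus.proj S y) α α' ^ 2 with hK2
  set E2 : ZdSite → ZdSite → ℝ := fun x y =>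
    cm2 μ (Fsite (Torus.proj S x)) (Fsite (Torus.proj S y)) - β⁻¹ ^ 2 / 2 * K2 x y with hE2
  have hE2b : ∀ x y, |E2 x y| ≤ C * η + 10 * ε ^ 6 + C * β⁻¹ ^ 2 * ξ := fun x y => site _ _
  have hsplit : ∀ x y : ZdSite,
      w (a • siteToE x) * thetaTest 4 w (a • siteToE y) * cm2 μ (Fsite (Torus.proj S x)) (Fsite (Torus.proj S y)) =
        β⁻¹ ^ 2 / 2 * (w (a • siteToE x) * thetaTest 4 w (a • siteToE y) * K2 x y) +
          w (a • siteToE x) * thetaTest 4 w (a • siteToE y) * E2 x y := by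
    intro x y; simp only [hE2]; ring
  simp_rw [hsplit, Finset.sum_add_distrib, ← Finset.mul_sum]
  -- diagonal drops out of the main part
  have hdiag : ∑ x ∈ box 4 L, ∑ y ∈ box 4 L, w (a • siteToE x) * thetaTest 4 w (a • siteToE y) * K2 x y =
      ∑ x ∈ box 4 L, ∑ y ∈ (box 4 L).erase x, w (a • siteToE x) * thetaTest 4 w (a • siteToE y) * K2 x y := by
    refine Finset.sum_congr rfl fun x _ => ?_
    rw [← Finset.sum_erase (box 4 L) (a := x)]
    rw [mul_thetaTest_eq_zero hw, zero_mul]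
  rw [hdiag]
  -- the error part
  have herr : |∑ x ∈ box 4 L, ∑ y ∈ box 4 L, w (a • siteToE x) * thetaTest 4 w (a • siteToE y) * E2 x y| ≤
      (Cw * a⁻¹ ^ 4) * (Ct * a⁻¹ ^ 4) * (C * η + 10 * ε ^ 6 + C * β⁻¹ ^ 2 * ξ) := by
    have herr0 : 0 ≤ C * η + 10 * ε ^ 6 + C * β⁻¹ ^ 2 * ξ := by positivity
    calc |∑ x ∈ box 4 L, ∑ y ∈ box 4 L, w (a • siteToE x) * thetaTest 4 w (a • siteToE y) * E2 x y|
        ≤ ∑ x ∈ box 4 L, ∑ y ∈ box 4 L, |w (a • siteToE x)| * |thetaTest 4 w (a • siteToE y)| *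
            (C * η + 10 * ε ^ 6 + C * β⁻¹ ^ 2 * ξ) := by
          refine (Finset.abs_sum_le_sum_abs _ _).trans (Finset.sum_le_sum fun x _ => ?_)
          refine (Finset.abs_sum_le_sum_abs _ _).trans (Finset.sum_le_sum fun y _ => ?_)
          rw [abs_mul, abs_mul]
          exact mul_le_mul_of_nonneg_left (hE2b x y) (by positivity)
      _ = (∑ x ∈ box 4 L, |w (a • siteToE x)|) * (∑ y ∈ box 4 L, |thetaTest 4 w (a • siteToE y)|) *
            (C * η + 10 * ε ^ 6 + C * β⁻¹ ^ 2 * ξ) :=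
          sum2_mul_factor (box 4 L) (fun x => |w (a • siteToE x)|) (fun y => |thetaTest 4 w (a • siteToE y)|) _
      _ ≤ (Cw * a⁻¹ ^ 4) * (Ct * a⁻¹ ^ 4) * (C * η + 10 * ε ^ 6 + C * β⁻¹ ^ 2 * ξ) := by
          have s0 : ∀ v : SchwartzMap (EuclideanSpace ℝ (Fin 4)) ℝ, 0 ≤ ∑ x ∈ box 4 L, |v (a • siteToE x)| :=
            fun v => Finset.sum_nonneg fun _ _ => abs_nonneg _
          refine mul_le_mul_of_nonneg_right ?_ herr0
          exact mul_le_mul (hCw a ha ha1 L) (hCt a ha ha1 L) (s0 _) (by positivity)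
  have e0 : a ^ 8 * (β⁻¹ ^ 2 / 2 * ∑ x ∈ box 4 L, ∑ y ∈ (box 4 L).erase x,
            w (a • siteToE x) * thetaTest 4 w (a • siteToE y) * K2 x y +
          ∑ x ∈ box 4 L, ∑ y ∈ box 4 L, w (a • siteToE x) * thetaTest 4 w (a • siteToE y) * E2 x y) -
        a ^ 8 * (β⁻¹ ^ 2 / 2) * ∑ x ∈ box 4 L, ∑ y ∈ (box 4 L).erase x,
          w (a • siteToE x) * thetaTest 4 w (a • siteToE y) * K2 x y =
      a ^ 8 * ∑ x ∈ box 4 L, ∑ y ∈ box 4 L, w (a • siteToE x) * thetaTest 4 w (a • siteToE y) * E2 x y := by ring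
  rw [e0, abs_mul, abs_of_pos (by positivity : (0 : ℝ) < a ^ 8)]
  calc a ^ 8 * |∑ x ∈ box 4 L, ∑ y ∈ box 4 L, w (a • siteToE x) * thetaTest 4 w (a • siteToE y) * E2 x y|
      ≤ a ^ 8 * ((Cw * a⁻¹ ^ 4) * (Ct * a⁻¹ ^ 4) * (C * η + 10 * ε ^ 6 + C * β⁻¹ ^ 2 * ξ)) :=
        mul_le_mul_of_nonneg_left herr (by positivity)
    _ = Cw * Ct * (C * η + 10 * ε ^ 6 + C * β⁻¹ ^ 2 * ξ) := by
        field_simp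
    _ ≤ Cw * Ct * ((C + 10 + C) * (η + ε ^ 6 + β⁻¹ ^ 2 * ξ)) := by
        have t2 : C * η + 10 * ε ^ 6 + C * β⁻¹ ^ 2 * ξ ≤ (C + 10 + C) * (η + ε ^ 6 + β⁻¹ ^ 2 * ξ) := by
          have e : (C + 10 + C) * (η + ε ^ 6 + β⁻¹ ^ 2 * ξ) - (C * η + 10 * ε ^ 6 + C * β⁻¹ ^ 2 * ξ) =
              (C + 10) * η + (C + C) * ε ^ 6 + (C + 10) * (β⁻¹ ^ 2 * ξ) := by ring
          have hp : 0 ≤ (C + 10) * η + (C + C) * ε ^ 6 + (C + 10) * (β⁻¹ ^ 2 * ξ) := by positivity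
          linarith
        exact mul_le_mul_of_nonneg_left t2 (by positivity)
    _ = Cw * Ct * (C + 10 + C) * (η + ε ^ 6 + β⁻¹ ^ 2 * ξ) := by ring

end Summit.QuantumFields.YangMills.Theorems.SelfNormalisedSkewness.Negative

end
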